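import Literature.AlgebraicGeometry.Resolution.RegularSystemOfParameters
import Literature.AlgebraicGeometry.Resolution.RegularLocalRingsQuotient
import Mathlib.Algebra.BigOperators.Associated
import Mathlib.Algebra.Prime.Lemmas
import HarnessLib

/-!
# [OURS · L1 W4.2] σ-LAYER, TAME TIER — (G4c): «a member surface `D = V(u_a)` inside the TOP LOCUS never passes through a TAME corner»
# — the divisibility kernel, over an ABSTRACT reading (crux `SigmaMaxModifications` stmt-ResolutionOfSingularities-18506 / conjunct stmt-…-19249,
# line `w_ladder`, CORE `stub_hybridEliminationHyp3S`, TAME-FORK §5 (G4c); `--supports 19249`, helper)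

Seat res-D-pv-038 (gen 9), res-L1-w42-plan-1 RULING v3.14-45 (KS) «(G4c) lemma → res-D-pv-038 NOW … if the (M,N,S) reading is not importable yet,
state it over an abstract reading with the two laws you need and say so». Sorry-free PROOF file, no definition, no named fact. OURS bookkeeping for the W4.2
crux chain (cell res-hironaka); NOT a statement of [Hironaka2017] nor of [CossartJannsenSaito2020]. AI-written; AI review is weaker than expert review.

## The claim (res-L1-w42-plan-1 `L/res-L1-w42-plan-1/TAME-FORK.md` §5 (G4c), [OURS])

At a live TAME corner `g` the ideal on the contact hypersurface germ `H` (regular local ring `R = 𝒪_{H,g}`, boundary members `E_i = V(u_i)` through `g`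
part of a regular system of parameters `u`) factors as `I_g = M · N`, `M = ∏ u_i^{β_i}` the MAXIMAL monomial factor (so `u_i ∤ N` for every `i`), `N`
the non-monomial factor with `S = ord_g N ≥ 1`, and the top value of the order is `m = Σ β_i + S`. «A member SURFACE `D = V(u_a)` inside the top locus
through `g` is impossible: at the generic point of `D`, `ord I ≥ m` forces `ord_D N = S`, i.e. `u_a^S ∣ N`, contradicting that `N` is the non-monomial
factor.» The σ-layer's corner kinds (`…Corridor3SigmaMenuGate` `CornerKind.tame`) carry NO `(M, N, S)` reading in the tree today (res-type-067's corner
model is not landed), so — as the ruling directs — this file proves the claim over an ABSTRACT reading, with exactly TWO laws as hypotheses: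

* LAW 1 («`D = V(u_a)` lies inside the top locus», read at the generic point `η` of `D`, where `𝒪_{H,η} = R_{(u_a)}` is a discrete valuation ring with
  uniformiser `u_a`): `ord_η (M·N) ≥ m`, i.e. `M·N ∈ (u_a)^m R_{(u_a)} ∩ R`, typed as **`∃ s, ¬ u_a ∣ s ∧ u_a ^ m ∣ s * (M * N)`**;
* LAW 2 («`N` is the non-monomial factor»): **`¬ u_a ∣ N`**;

plus the corner arithmetic `β_a < m` (automatic from `m = Σ β_i + S`, `S ≥ 1`). The consumer (067's successor / res-L1-type-o1's `tameGate`, idea-2's card S)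
instantiates LAW 1 from its order reading and LAW 2 from its definition of the monomial part; nothing else of the corner model is used.

## Contents

* §1 `dvd_of_prime_pow_dvd_monomial_mul` — in a cancellative commutative monoid with zero: `q` prime, `q ∤ u_i` (`i ≠ a`), `u_a = q`, `β_a < m`,
  `q^m ∣ (∏ u_i^{β_i}) · N` ⇒ `q ∣ N`; `prime_pow_dvd_of_dvd_mul_of_not_dvd` — the symbolic-power bridge `q ∤ s ∧ q^m ∣ s·f ⇒ q^m ∣ f` (Mathlib's
  `Prime.pow_dvd_of_dvd_mul_left`, recorded in the reading's shape).
* §2 `not_memberSurface_in_topLocus_abstract` — **(G4c) over the abstract reading**: LAW 1 ∧ LAW 2 ∧ `β_a < m` ⇒ `False`, for `u_a` prime and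
  `u_a ∤ u_i` (`i ≠ a`) in any cancellative commutative monoid with zero.
* §3 the REGULAR-LOCAL-RING instance: for a regular system of parameters `u : Fin d → R` of a regular local ring (`span (range u) = 𝔪`,
  `d = emb.dim R`), `u_a` IS prime (`IsRegularLocalRing.prime_of_not_mem_sq` through `isPrime_span_image`) and `u_a ∤ u_i` for `i ≠ a`
  (`not_mem_span_image_of_not_mem`, Matsumura 14.2) — so **`not_memberSurface_in_topLocus_of_rsop`** needs only LAW 1, LAW 2 and `β_a < m`
  (or `m = Σ β_i + S`, `1 ≤ S`: `not_memberSurface_in_topLocus_of_rsop'`).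

[OURS · L1 W4.2; AI-written] [cite: Matsumura1987, Thm. 14.2, Thm. 14.3]
-/

noncomputable section

set_option linter.dupNamespace false

open IsLocalRing Literature.AlgebraicGeometry.Resolution

namespace Summit.ResolutionOfSingularities.ResolutionOfSingularities.Theorems.SigmaMaxModificationsCorridor3.Sigma

universe u

/-! ## §1. Divisibility kernels -/

section Monoid

variable {M₀ : Type u} [CommMonoidWithZero M₀] [IsCancelMulZero M₀] {ι : Type*} [DecidableEq ι]

/-- **A prime power dividing `monomial × N` beyond its own exponent divides `N`**: `q` prime, `u_a = q`, `q ∤ u_i` for `i ≠ a`, `β_a < m` and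
`q ^ m ∣ (∏_{i ∈ s} u_i ^ β_i) * N` ⇒ `q ∣ N`. [folklore] -/
theorem dvd_of_prime_pow_dvd_monomial_mul {q : M₀} (hq : Prime q) {s : Finset ι} {u : ι → M₀} {β : ι → ℕ} {a : ι} (ha : a ∈ s)
    (hua : u a = q) (hind : ∀ i ∈ s, i ≠ a → ¬ q ∣ u i) {m : ℕ} (hm : β a < m) {N : M₀}
    (h : q ^ m ∣ (∏ i ∈ s, u i ^ β i) * N) : q ∣ N := by
  -- split off the `a`-factor of the monomial
  rw [← Finset.mul_prod_erase s (fun i => u i ^ β i) ha, hua, mul_assoc] at h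
  -- `q` does not divide the rest of the monomial
  have hrest : ¬ q ∣ ∏ i ∈ s.erase a, u i ^ β i := by
    refine hq.not_dvd_finsetProd fun i hi hdiv => ?_
    obtain ⟨hia, his⟩ := Finset.mem_erase.mp hi
    exact hind i his hia (hq.dvd_of_dvd_pow hdiv)
  -- cancel `q ^ β_a`: `q ^ (m - β_a) ∣ rest * N`, and `m - β_a ≥ 1`
  obtain ⟨k, hk⟩ := Nat.exists_eq_add_of_lt hm
  have hk' : m = β a + (k + 1) := by omega
  rw [hk', pow_add] at h
  have h2 : q ^ (k + 1) ∣ (∏ i ∈ s.erase a, u i ^ β i) * N :=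
    (mul_dvd_mul_iff_left (pow_ne_zero _ hq.ne_zero)).mp h
  have h3 : q ^ (k + 1) ∣ N := hq.pow_dvd_of_dvd_mul_left (k + 1) hrest h2
  exact (dvd_pow_self q (Nat.succ_ne_zero k)).trans h3

/-- **The symbolic-power bridge** (LAW 1's shape): `q` prime, `q ∤ s`, `q ^ m ∣ s * f` ⇒ `q ^ m ∣ f` — «`ord_η f ≥ m` at the generic point `η` of `V(q)`,
read in `R_{(q)}`, descends to `R`». Mathlib's `Prime.pow_dvd_of_dvd_mul_left`. [folklore] -/
theorem prime_pow_dvd_of_dvd_mul_of_not_dvd {q s f : M₀} (hq : Prime q) {m : ℕ} (hs : ¬ q ∣ s) (h : q ^ m ∣ s * f) : q ^ m ∣ f :=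
  hq.pow_dvd_of_dvd_mul_left m hs h

/-! ## §2. (G4c) over the abstract reading -/

/-- **(G4c) OVER THE ABSTRACT READING — a member surface `V(u_a)` inside the top locus never passes through a tame corner.** In a cancellative
commutative monoid with zero, let `u_a` be prime with `u_a ∤ u_i` (`i ≠ a`), `M = ∏_{i ∈ s} u_i^{β_i}`, and `β_a < m` (at a tame corner:
`m = Σ β_i + S`, `S ≥ 1`). Then LAW 1 «`V(u_a) ⊆` top locus» (`∃ t, u_a ∤ t ∧ u_a^m ∣ t · (M · N)`) and LAW 2 «`N` is the non-monomial factor»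
(`u_a ∤ N`) are contradictory. [OURS · L1 W4.2; AI-written] -/
theorem not_memberSurface_in_topLocus_abstract {s : Finset ι} {u : ι → M₀} {β : ι → ℕ} {a : ι} (ha : a ∈ s) (hprime : Prime (u a))
    (hind : ∀ i ∈ s, i ≠ a → ¬ u a ∣ u i) {m : ℕ} (hm : β a < m) {N : M₀}
    (law1 : ∃ t, ¬ u a ∣ t ∧ u a ^ m ∣ t * ((∏ i ∈ s, u i ^ β i) * N)) (law2 : ¬ u a ∣ N) : False := by
  obtain ⟨t, ht, hdiv⟩ := law1
  have h : u a ^ m ∣ (∏ i ∈ s, u i ^ β i) * N := prime_pow_dvd_of_dvd_mul_of_not_dvd hprime ht hdiv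
  exact law2 (dvd_of_prime_pow_dvd_monomial_mul hprime ha rfl hind hm h)

end Monoid

/-! ## §3. The regular-local-ring instance: regular parameters are prime and pairwise non-dividing -/

section RegularLocal

variable {R : Type u} [CommRing R] [IsRegularLocalRing R] {d : ℕ} (hd : (maximalIdeal R).spanFinrank = d)
  (u : Fin d → R) (hu : Ideal.span (Set.range u) = maximalIdeal R)

include hd hu

/-- A member `u_a` of a regular system of parameters does not divide another member `u_i`, `i ≠ a` (minimality of the basis of `𝔪`,
`not_mem_span_image_of_not_mem`). [cite: Matsumura1987, Thm. 14.2] -/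
theorem rsop_not_dvd_of_ne {a i : Fin d} (hia : i ≠ a) : ¬ u a ∣ u i := by
  intro hdiv
  have hmem : u i ∈ Ideal.span (u '' ({a} : Set (Fin d))) := by
    rw [Set.image_singleton]
    exact Ideal.mem_span_singleton.mpr hdiv
  exact not_mem_span_image_of_not_mem hd u hu (S := ({a} : Set (Fin d))) (by simpa using hia) hmem

/-- A member of a regular system of parameters is a PRIME element (the ideal it generates is prime: `isPrime_span_image` with `S = {a}`,
Matsumura 14.3/17.8). [cite: Matsumura1987, Thm. 14.3] -/
theorem rsop_prime (a : Fin d) : Prime (u a) := by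
  classical
  have hP : (Ideal.span (u '' (({a} : Finset (Fin d)) : Set (Fin d)))).IsPrime := isPrime_span_image hd u hu {a}
  rw [Finset.coe_singleton, Set.image_singleton] at hP
  have hne : u a ≠ 0 := by
    intro h0
    -- `u_a = 0` would lie in the span of the other members (indeed in `⊥`)
    have : u a ∈ Ideal.span (u '' (∅ : Set (Fin d))) := by rw [h0]; exact Ideal.zero_mem _
    exact not_mem_span_image_of_not_mem hd u hu (S := (∅ : Set (Fin d))) (by simp) this
  exact (Ideal.span_singleton_prime hne).mp hP

/-- **(G4c) AT A TAME CORNER OF A REGULAR GERM** — for a regular system of parameters `u : Fin d → R` of the regular local ring `R = 𝒪_{H,g}`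
(`span (range u) = 𝔪`, `d = emb.dim R`), an index `a`, exponents `β`, the non-monomial factor `N` and a top value `m > β_a`: LAW 1 («`V(u_a) ⊆` top
locus», `∃ t, u_a ∤ t ∧ u_a^m ∣ t·(∏ u_i^{β_i} · N)`) and LAW 2 (`u_a ∤ N`) cannot both hold. The two laws are the consumer's instantiation obligations
(module docstring). [OURS · L1 W4.2; AI-written] [cite: Matsumura1987, Thm. 14.2, Thm. 14.3] -/
theorem not_memberSurface_in_topLocus_of_rsop (a : Fin d) (β : Fin d → ℕ) {m : ℕ} (hm : β a < m) {N : R}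
    (law1 : ∃ t, ¬ u a ∣ t ∧ u a ^ m ∣ t * ((∏ i, u i ^ β i) * N)) (law2 : ¬ u a ∣ N) : False := by
  classical
  haveI : IsDomain R := isDomain_of_isRegularLocalRing R
  exact not_memberSurface_in_topLocus_abstract (s := Finset.univ) (Finset.mem_univ a) (rsop_prime hd u hu a)
    (fun i _ hia => rsop_not_dvd_of_ne hd u hu hia) hm law1 law2

/-- **(G4c), tame-corner arithmetic spelled out**: with `m = Σ β_i + S` and `S ≥ 1` (a TAME corner: the non-monomial factor has positive order),
`β_a < m` is automatic. [OURS · L1 W4.2; AI-written] -/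
theorem not_memberSurface_in_topLocus_of_rsop' (a : Fin d) (β : Fin d → ℕ) {S m : ℕ} (hS : 1 ≤ S) (hm : m = ∑ i, β i + S) {N : R}
    (law1 : ∃ t, ¬ u a ∣ t ∧ u a ^ m ∣ t * ((∏ i, u i ^ β i) * N)) (law2 : ¬ u a ∣ N) : False := by
  classical
  have hβ : β a ≤ ∑ i, β i := Finset.single_le_sum (f := β) (fun _ _ => Nat.zero_le _) (Finset.mem_univ a)
  exact not_memberSurface_in_topLocus_of_rsop hd u hu a β (m := m) (by omega) law1 law2

/-- **The global form of LAW 1 suffices**: if `M · N ∈ (u_a)^m` in `R` itself (e.g. the top locus contains `V(u_a)` because `I ⊆ 𝔭_D^m` globally),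
take `t = 1`. [OURS · L1 W4.2; AI-written] -/
theorem not_memberSurface_in_topLocus_of_rsop_of_mem_pow (a : Fin d) (β : Fin d → ℕ) {m : ℕ} (hm : β a < m) {N : R}
    (hmem : (∏ i, u i ^ β i) * N ∈ (Ideal.span {u a}) ^ m) (law2 : ¬ u a ∣ N) : False := by
  refine not_memberSurface_in_topLocus_of_rsop hd u hu a β hm ⟨1, ?_, ?_⟩ law2
  · intro h
    exact (rsop_prime hd u hu a).not_unit (isUnit_of_dvd_one h)
  · rw [one_mul, ← Ideal.mem_span_singleton, ← Ideal.span_singleton_pow]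
    exact hmem

end RegularLocal

/-! ## §4 (appended 2026-08-27, same seat). LAW 1 from the ORDER READING in the local ring at the generic point of `V(u_a)` -/

section Localization

variable {R : Type u} [CommRing R]

/-- **LAW 1 FROM THE LOCAL-RING READING, any prime.** If the image of `f` in a localization `Rₚ` of `R` at the prime `𝔭` lies in `(𝔪_{Rₚ})^m` — «the
order of `f` at the generic point `η` of `V(𝔭)` is `≥ m`», read in `𝒪_{H,η} = Rₚ` — then `t · f ∈ 𝔭^m` for some `t ∉ 𝔭`. (No domain hypothesis:
`IsLocalization.eq_iff_exists` supplies the extra unit.) [folklore] -/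
theorem exists_notMem_mul_mem_pow_of_mem_pow_maximalIdeal_localization (𝔭 : Ideal R) [𝔭.IsPrime] (Rₚ : Type u) [CommRing Rₚ]
    [Algebra R Rₚ] [IsLocalization.AtPrime Rₚ 𝔭] [IsLocalRing Rₚ] {f : R} {m : ℕ}
    (h : algebraMap R Rₚ f ∈ (maximalIdeal Rₚ) ^ m) : ∃ t, t ∉ 𝔭 ∧ t * f ∈ 𝔭 ^ m := by
  rw [← IsLocalization.AtPrime.map_eq_maximalIdeal 𝔭 Rₚ, ← Ideal.map_pow] at h
  obtain ⟨⟨⟨x, hx⟩, s⟩, hxs⟩ := (IsLocalization.mem_map_algebraMap_iff 𝔭.primeCompl Rₚ).mp h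
  -- `φ (f * s) = φ x`, hence `c * (f * s) = c * x` for some `c ∉ 𝔭`
  have heq : algebraMap R Rₚ (f * s) = algebraMap R Rₚ x := by
    rw [map_mul]
    exact hxs
  obtain ⟨c, hc⟩ := (IsLocalization.eq_iff_exists 𝔭.primeCompl Rₚ).mp heq
  refine ⟨c * s, ?_, ?_⟩
  · intro hmem
    rcases (‹𝔭.IsPrime›).mem_or_mem hmem with hc' | hs'
    · exact c.2 hc'
    · exact s.2 hs'
  · have : (c : R) * s * f = c * x := by
      rw [mul_assoc, mul_comm (s : R) f]
      exact hc
    rw [this]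
    exact Ideal.mul_mem_left _ _ hx

/-- **LAW 1 FROM THE DVR READING at the generic point of the member surface `V(q)`** (`q` a non-zero element generating a prime ideal, e.g. a member
`u_a` of a regular system of parameters): `φ f ∈ (𝔪_{R_{(q)}})^m` ⇒ `∃ t, q ∤ t ∧ q^m ∣ t · f` — exactly the `law1` binder of
`not_memberSurface_in_topLocus_abstract` / `…_of_rsop`. [folklore] -/
theorem law1_of_mem_pow_maximalIdeal_localization {q : R} (𝔭 : Ideal R) [𝔭.IsPrime] (h𝔭 : 𝔭 = Ideal.span {q}) (Rₚ : Type u)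
    [CommRing Rₚ] [Algebra R Rₚ] [IsLocalization.AtPrime Rₚ 𝔭] [IsLocalRing Rₚ] {f : R} {m : ℕ}
    (h : algebraMap R Rₚ f ∈ (maximalIdeal Rₚ) ^ m) : ∃ t, ¬ q ∣ t ∧ q ^ m ∣ t * f := by
  obtain ⟨t, ht, htf⟩ := exists_notMem_mul_mem_pow_of_mem_pow_maximalIdeal_localization 𝔭 Rₚ h
  subst h𝔭
  refine ⟨t, fun hdiv => ht (Ideal.mem_span_singleton.mpr hdiv), ?_⟩
  rwa [Ideal.span_singleton_pow, Ideal.mem_span_singleton] at htf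

end Localization

end Summit.ResolutionOfSingularities.ResolutionOfSingularities.Theorems.SigmaMaxModificationsCorridor3.Sigma

end
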